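import Summits.QuantumAdvantage.QuantumAdvantage.Theorems.WbwObfuscatedGluedTreesKowRiVocabulary
import Summits.QuantumAdvantage.QuantumAdvantage.Theorems.WbwObfuscatedGluedTreesKowBbFibre

/-!
# Stub `stub_prpTable` — the format bridge `prp = joinVec ∘ psi (effKey) ∘ splitVec` and uniformity of the
# effective key (crux `WbwObfuscatedGluedTrees`, stmt-QuantumAdvantage-2340; line `knowledge-of-walk-split`, stage 6)

Registered stub of the stage-6 skeleton (target `…KnowledgeOfWalkSplit.RealIdeal.IdealCodeSoundness`), the FORMAT
BRIDGE between the generator's keyed four-round Feistel permutation `prp`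
(`Literature/Computability/Cryptography/ObfuscatedGluedTrees.lean` §4) run over the table scheme `tabScheme H` of the
stage-6 vocabulary and the abstract Luby–Rackoff network `psi` counted by the coefficient-H step:

* (i) `prp (tabScheme H) μ (tkey i) d w = joinVec d (psi (effKey (H.tab i) d) (splitVec d w))`: a low-half
  round `feistelRound (lowHalf d) F` replaces the low half `A` of `w = joinVec d (A, B)` by
  `A ⊕ (F (joinVec d (0, B))).low` and keeps `B`; a high-half round symmetrically; the round functions over the
  table scheme are `roundFnT (H.tab i) d r`;
* (ii) for `d + 8 ≤ μ` every fibre of `H ↦ effKey H d : PrfTable μ → LRKey ⌊d/2⌋ ⌈d/2⌉` has the same size (stated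
  cross-multiplied: `#fibre · |LRKey| = |PrfTable μ|`).  The effective key reads the table at the points
  `vecOf μ (⟨r⟩₈ ++ y)` (round `r`, blanked vector `y`), an INJECTIVE family since the first eight coordinates
  carry `r` and the next `d` carry `y` (`effKey_factor`); so `H ↦ effKey H d` factors through the restriction to
  an injective family (constant fibres: functions with prescribed values, `card_fun_prescribed`) followed by a
  coordinatewise map whose fibres are products of fibres of the low-half / high-half coordinate projections (again
  `card_fun_prescribed`), hence constant (`card_fibre_effKey_const`).

[cite: LubyRackoff1988, main construction] for the network; the counting is [folklore].
-/

set_option linter.dupNamespace false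

noncomputable section

namespace Summit.QuantumAdvantage.QuantumAdvantage.Theorems.WbwObfuscatedGluedTrees.KnowledgeOfWalk.RealIdeal

open Literature.Computability.Complexity Literature.Computability.QuantumComplexity
open Literature.Computability.QuantumComplexity.GluedTrees
open Literature.Computability.Cryptography Literature.Computability.Cryptography.ObfuscatedGluedTrees
open Summit.QuantumAdvantage.QuantumAdvantage.Theorems.WbwObfuscatedGluedTrees.KnowledgeOfWalk.BlackBox
open Finset

namespace PrpTable

variable {μ d : ℕ}

/-! ## §1 Conjunct (i): the generator's `prp` over the table scheme is `psi` at the effective key -/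

/-- Over the table scheme, the generator's round function of key `tkey i` is the round function `roundFnT` of table
`i`. [folklore] -/
theorem roundFn_tabScheme (H : CodeSpace μ) (i : Fin 4) (d r : ℕ) :
    ObfuscatedGluedTrees.roundFn (tabScheme H) μ (tkey i) d r = roundFnT (H.tab i) d r := by
  funext y j
  unfold ObfuscatedGluedTrees.roundFn roundFnT
  rw [prf_tabScheme]

/-- Blanking the low half of `w` leaves `joinVec d (0, high half of w)`. [folklore] -/
theorem blank_lowHalf (w : Fin d → Bool) :
    (fun j => if lowHalf d j then false else w j) = joinVec d (fun _ => false, (splitVec d w).2) := by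
  funext j
  by_cases h : (j : ℕ) < d / 2
  · simp [lowHalf, joinVec, h]
  · simp only [lowHalf, joinVec, splitVec, h, decide_false, Bool.false_eq_true, ↓reduceIte, ↓reduceDIte]
    exact congrArg w (Fin.ext (by simp only; omega))

/-- Blanking the high half of `w` leaves `joinVec d (low half of w, 0)`. [folklore] -/
theorem blank_highHalf (w : Fin d → Bool) :
    (fun j => if highHalf d j then false else w j) = joinVec d ((splitVec d w).1, fun _ => false) := by
  funext j
  by_cases h : (j : ℕ) < d / 2
  · have h' : ¬ d / 2 ≤ (j : ℕ) := by omega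
    simp [highHalf, joinVec, splitVec, h, h']
  · have h' : d / 2 ≤ (j : ℕ) := by omega
    simp [highHalf, joinVec, h, h']

/-- A LOW-half Feistel round seen on the halves: `(A, B) ↦ (A ⊕ (F (joinVec d (0, B))).low, B)`.
[cite: LubyRackoff1988, main construction] -/
theorem splitVec_feistelRound_lowHalf (F : (Fin d → Bool) → (Fin d → Bool)) (w : Fin d → Bool) :
    splitVec d (ObfuscatedGluedTrees.feistelRound (lowHalf d) F w) =
      (xorVec (splitVec d w).1 (splitVec d (F (joinVec d (fun _ => false, (splitVec d w).2)))).1,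
        (splitVec d w).2) := by
  unfold ObfuscatedGluedTrees.feistelRound
  rw [blank_lowHalf w]
  refine Prod.ext ?_ ?_
  · funext i
    simp [splitVec, xorVec, lowHalf]
  · funext j
    simp [splitVec, lowHalf]

/-- A HIGH-half Feistel round seen on the halves: `(A, B) ↦ (A, B ⊕ (F (joinVec d (A, 0))).high)`.
[cite: LubyRackoff1988, main construction] -/
theorem splitVec_feistelRound_highHalf (F : (Fin d → Bool) → (Fin d → Bool)) (w : Fin d → Bool) :
    splitVec d (ObfuscatedGluedTrees.feistelRound (highHalf d) F w) =
      ((splitVec d w).1,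
        xorVec (splitVec d w).2 (splitVec d (F (joinVec d ((splitVec d w).1, fun _ => false)))).2) := by
  unfold ObfuscatedGluedTrees.feistelRound
  rw [blank_highHalf w]
  refine Prod.ext ?_ ?_
  · funext i
    simp [splitVec, highHalf]
  · funext j
    simp [splitVec, xorVec, highHalf]

/-- **Conjunct (i)**: the generator's keyed permutation over the table scheme is the abstract four-round network at the
effective key of the selected table, conjugated by `splitVec` / `joinVec`. [cite: LubyRackoff1988, main construction] -/
theorem prp_tabScheme (H : CodeSpace μ) (i : Fin 4) (w : Fin d → Bool) :
    prp (tabScheme H) μ (tkey i) d w = joinVec d (psi (effKey (H.tab i) d) (splitVec d w)) := by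
  rw [← joinVec_splitVec d (prp (tabScheme H) μ (tkey i) d w)]
  congr 1
  simp only [prp, Equiv.trans_apply, feistelPerm_apply, roundFn_tabScheme, splitVec_feistelRound_highHalf,
    splitVec_feistelRound_lowHalf, psi, effKey]

/-! ## §2 Maps all of whose fibres have the same size -/

/-- If every fibre of `f : X → Y` has `m` elements then `m · |Y| = |X|`. [folklore] -/
theorem mul_card_of_fibre {X Y : Type*} [Fintype X] [Fintype Y] [DecidableEq Y] (f : X → Y) (m : ℕ)
    (h : ∀ y, (univ.filter fun x => f x = y).card = m) : m * Fintype.card Y = Fintype.card X := by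
  rw [← Finset.card_univ (α := X), Finset.card_eq_sum_card_fiberwise (f := f) (t := univ) fun x _ => by simp,
    Finset.sum_congr rfl fun y _ => h y, sum_const, smul_eq_mul, card_univ, mul_comm]

/-- Fibres of a composite of two maps with constant fibre sizes have the product size. [folklore] -/
theorem card_fibre_comp {X Y Z : Type*} [Fintype X] [Fintype Y] [DecidableEq Y] [DecidableEq Z]
    (f : X → Y) (g : Y → Z) (m n : ℕ) (hf : ∀ y, (univ.filter fun x => f x = y).card = m)
    (hg : ∀ z, (univ.filter fun y => g y = z).card = n) (z : Z) :
    (univ.filter fun x => g (f x) = z).card = n * m := by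
  rw [Finset.card_eq_sum_card_fiberwise (f := f) (s := univ.filter fun x => g (f x) = z)
    (t := univ.filter fun y => g y = z) fun x hx => by simpa using hx, ← hg z]
  refine Finset.sum_const_nat fun y hy => ?_
  rw [← hf y]
  congr 1
  ext x
  simp only [mem_filter, mem_univ, true_and, and_iff_right_iff_imp]
  intro hx
  rw [hx]
  exact (mem_filter.1 hy).2

/-- Restriction along an INJECTIVE family `ι : V → A` has constant fibres on `A → B`: the functions with prescribed
values at the points `ι v` number `|B| ^ (|A| - |V|)` (`card_fun_prescribed`). [folklore] -/
theorem card_fibre_restrict {V A B : Type*} [Fintype V] [Fintype A] [DecidableEq A] [Fintype B] [DecidableEq B]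
    (ι : V → A) (hι : Function.Injective ι) (c : V → B) :
    (univ.filter fun T : A → B => (fun v => T (ι v)) = c).card =
      Fintype.card B ^ (Fintype.card A - Fintype.card V) := by
  classical
  rw [← card_fun_prescribed ι hι c, Fintype.card_subtype]
  congr 1
  ext T
  simp [funext_iff]

/-! ## §3 The table points read by the effective key -/

/-- `roundFnT` reads the table at the `μ`-bit reading of `⟨r⟩₈ ++ y`, cut to `d` bits. [folklore] -/
theorem roundFnT_eq (H : PrfTable μ) (d r : ℕ) (y : Fin d → Bool) :
    roundFnT H d r y = vecOf d (List.ofFn (H (vecOf μ (bitsOf 8 r ++ List.ofFn y)))) := by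
  rw [← vecOf_fit le_rfl]; rfl

/-- The first eight coordinates of the reading of `⟨r⟩₈ ++ y` are the bits of `r`. [folklore] -/
theorem inp_apply_lt (h : d + 8 ≤ μ) (r : ℕ) (y : Fin d → Bool) (t : ℕ) (ht : t < 8) :
    vecOf μ (bitsOf 8 r ++ List.ofFn y) ⟨t, by omega⟩ = r.testBit t := by
  simp only [vecOf]
  rw [List.getD_append _ _ _ _ (by simpa using ht), List.getD_eq_getElem?_getD, bitsOf, List.getElem?_ofFn]
  simp [ht]

/-- Coordinates `8, …, 8 + d - 1` of the reading of `⟨r⟩₈ ++ y` are `y`. [folklore] -/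
theorem inp_apply_mid (h : d + 8 ≤ μ) (r : ℕ) (y : Fin d → Bool) (p : Fin d) :
    vecOf μ (bitsOf 8 r ++ List.ofFn y) ⟨8 + p, by omega⟩ = y p := by
  simp only [vecOf]
  rw [List.getD_append_right _ _ _ _ (by simp)]
  simp [List.getD_eq_getElem?_getD]

/-- The reading of `⟨r⟩₈ ++ y` is injective in `(r, y)` for round indices below `2⁸`. [folklore] -/
theorem inp_inj (h : d + 8 ≤ μ) {r r' : ℕ} (hr : r < 2 ^ 8) (hr' : r' < 2 ^ 8) {y y' : Fin d → Bool}
    (he : vecOf μ (bitsOf 8 r ++ List.ofFn y) = vecOf μ (bitsOf 8 r' ++ List.ofFn y')) :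
    r = r' ∧ y = y' := by
  refine ⟨Nat.eq_of_testBit_eq fun t => ?_, funext fun p => ?_⟩
  · by_cases ht : t < 8
    · rw [← inp_apply_lt h r y t ht, ← inp_apply_lt h r' y' t ht, he]
    · push Not at ht
      rw [Nat.testBit_lt_two_pow (lt_of_lt_of_le hr (Nat.pow_le_pow_right two_pos ht)),
        Nat.testBit_lt_two_pow (lt_of_lt_of_le hr' (Nat.pow_le_pow_right two_pos ht))]
  · rw [← inp_apply_mid h r y p, ← inp_apply_mid h r' y' p, he]

/-- Reading a listed `μ`-bit vector at `d ≤ μ` bits is a coordinate restriction. [folklore] -/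
theorem vecOf_ofFn_apply (hd : d ≤ μ) (v : Fin μ → Bool) (p : Fin d) :
    vecOf d (List.ofFn v) p = v ⟨p, by omega⟩ := by
  have hp : (p : ℕ) < μ := by omega
  simp [vecOf, List.getD_eq_getElem?_getD, hp]

/-- The LOW half of the `d`-bit cut of a `μ`-bit value has fibres of `2 ^ (μ - ⌊d/2⌋)` elements. [folklore] -/
theorem card_fibre_low (hd : d ≤ μ) (x : Fin (d / 2) → Bool) :
    (univ.filter fun v : Fin μ → Bool => (splitVec d (vecOf d (List.ofFn v))).1 = x).card = 2 ^ (μ - d / 2) := by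
  have hread : ∀ v : Fin μ → Bool,
      (splitVec d (vecOf d (List.ofFn v))).1 = fun i => v (Fin.castLE (show d / 2 ≤ μ by omega) i) :=
    fun v => funext fun i => vecOf_ofFn_apply hd v ⟨i, by omega⟩
  have := card_fibre_restrict (B := Bool) (Fin.castLE (show d / 2 ≤ μ by omega)) (Fin.castLE_injective _) x
  simp only [Fintype.card_bool, Fintype.card_fin] at this
  rw [← this]
  congr 1
  ext v
  simp [hread]

/-- The HIGH half of the `d`-bit cut of a `μ`-bit value has fibres of `2 ^ (μ - ⌈d/2⌉)` elements. [folklore] -/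
theorem card_fibre_high (hd : d ≤ μ) (x : Fin (d - d / 2) → Bool) :
    (univ.filter fun v : Fin μ → Bool => (splitVec d (vecOf d (List.ofFn v))).2 = x).card =
      2 ^ (μ - (d - d / 2)) := by
  have hread : ∀ v : Fin μ → Bool,
      (splitVec d (vecOf d (List.ofFn v))).2 = fun j : Fin (d - d / 2) => v ⟨d / 2 + (j : ℕ), by omega⟩ :=
    fun v => funext fun j => vecOf_ofFn_apply hd v ⟨d / 2 + (j : ℕ), by omega⟩
  have hι : Function.Injective fun j : Fin (d - d / 2) => (⟨d / 2 + j, by omega⟩ : Fin μ) := by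
    intro j j' hj
    have := congrArg Fin.val hj
    exact Fin.ext (by simpa using this)
  have := card_fibre_restrict (B := Bool) _ hι x
  simp only [Fintype.card_bool, Fintype.card_fin] at this
  rw [← this]
  congr 1
  ext v
  simp [hread]

/-! ## §4 The effective key factors through the restriction to an injective family of table points -/

/-- Reading a four-round key coordinatewise off a family of values indexed by `VB ⊕ VA ⊕ VB ⊕ VA` through two readers
`lo`, `hi` with constant fibre sizes `m`, `n` has constant fibres (a product of fibres). [folklore] -/
theorem card_fibre_key4 {W VA VB : Type*} [Fintype W] [Fintype VA] [DecidableEq VA] [Fintype VB] [DecidableEq VB]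
    (lo : W → VA) (hi : W → VB) (m n : ℕ) (hlo : ∀ x, (univ.filter fun w => lo w = x).card = m)
    (hhi : ∀ y, (univ.filter fun w => hi w = y).card = n) (e : (VB → VA) × (VA → VB) × (VB → VA) × (VA → VB)) :
    (univ.filter fun c : VB ⊕ VA ⊕ VB ⊕ VA → W =>
      ((fun B => lo (c (Sum.inl B)), fun A => hi (c (Sum.inr (Sum.inl A))),
        fun B => lo (c (Sum.inr (Sum.inr (Sum.inl B)))), fun A => hi (c (Sum.inr (Sum.inr (Sum.inr A))))) :
          (VB → VA) × (VA → VB) × (VB → VA) × (VA → VB)) = e).card =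
      m ^ Fintype.card VB * (n ^ Fintype.card VA * (m ^ Fintype.card VB * n ^ Fintype.card VA)) := by
  classical
  -- the fibre is the box of the coordinatewise fibres
  set F : VB ⊕ VA ⊕ VB ⊕ VA → Finset W :=
    Sum.elim (fun B => univ.filter fun w => lo w = e.1 B)
      (Sum.elim (fun A => univ.filter fun w => hi w = e.2.1 A)
        (Sum.elim (fun B => univ.filter fun w => lo w = e.2.2.1 B) fun A => univ.filter fun w => hi w = e.2.2.2 A))
    with hF
  have hpi : (univ.filter fun c : VB ⊕ VA ⊕ VB ⊕ VA → W =>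
      ((fun B => lo (c (Sum.inl B)), fun A => hi (c (Sum.inr (Sum.inl A))),
        fun B => lo (c (Sum.inr (Sum.inr (Sum.inl B)))), fun A => hi (c (Sum.inr (Sum.inr (Sum.inr A))))) :
          (VB → VA) × (VA → VB) × (VB → VA) × (VA → VB)) = e) = Fintype.piFinset F := by
    ext c
    simp only [mem_filter, mem_univ, true_and, Fintype.mem_piFinset]
    constructor
    · rintro rfl (B | A | B | A) <;> simp [F]
    · intro hc
      refine Prod.ext (funext fun B => ?_) (Prod.ext (funext fun A => ?_)
        (Prod.ext (funext fun B => ?_) (funext fun A => ?_)))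
      · simpa [F] using hc (Sum.inl B)
      · simpa [F] using hc (Sum.inr (Sum.inl A))
      · simpa [F] using hc (Sum.inr (Sum.inr (Sum.inl B)))
      · simpa [F] using hc (Sum.inr (Sum.inr (Sum.inr A)))
  rw [hpi, Fintype.card_piFinset, Fintype.prod_sum_type, Fintype.prod_sum_type, Fintype.prod_sum_type]
  simp [F, hlo, hhi]

/-- **Factorisation**: for `d + 8 ≤ μ` the effective key reads the table at an INJECTIVE family of points indexed by
`VB ⊕ VA ⊕ VB ⊕ VA` (round `r` at the reading of `⟨r⟩₈ ++ blanked vector`; the first eight coordinates carry `r`,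
the next `d` the blanked vector) and uses the low / high half of the `d`-bit cut of each value. [folklore] -/
theorem effKey_factor (h : d + 8 ≤ μ) :
    ∃ ι : (Fin (d - d / 2) → Bool) ⊕ (Fin (d / 2) → Bool) ⊕ (Fin (d - d / 2) → Bool) ⊕ (Fin (d / 2) → Bool) →
        (Fin μ → Bool),
      Function.Injective ι ∧ ∀ H : PrfTable μ, effKey H d =
        (fun B => (splitVec d (vecOf d (List.ofFn (H (ι (Sum.inl B)))))).1,
          fun A => (splitVec d (vecOf d (List.ofFn (H (ι (Sum.inr (Sum.inl A))))))).2,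
          fun B => (splitVec d (vecOf d (List.ofFn (H (ι (Sum.inr (Sum.inr (Sum.inl B)))))))).1,
          fun A => (splitVec d (vecOf d (List.ofFn (H (ι (Sum.inr (Sum.inr (Sum.inr A)))))))).2) := by
  have hB : ∀ B B' : Fin (d - d / 2) → Bool,
      joinVec d (fun _ => false, B) = joinVec d (fun _ => false, B') → B = B' :=
    fun B B' h => by simpa using congrArg (fun w => (splitVec d w).2) h
  have hA : ∀ A A' : Fin (d / 2) → Bool,
      joinVec d (A, fun _ => false) = joinVec d (A', fun _ => false) → A = A' :=
    fun A A' h => by simpa using congrArg (fun w => (splitVec d w).1) h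
  refine ⟨Sum.elim (fun B => vecOf μ (bitsOf 8 0 ++ List.ofFn (joinVec d (fun _ => false, B))))
    (Sum.elim (fun A => vecOf μ (bitsOf 8 1 ++ List.ofFn (joinVec d (A, fun _ => false))))
      (Sum.elim (fun B => vecOf μ (bitsOf 8 2 ++ List.ofFn (joinVec d (fun _ => false, B))))
        fun A => vecOf μ (bitsOf 8 3 ++ List.ofFn (joinVec d (A, fun _ => false))))), ?_, fun H => ?_⟩
  · rintro (B | A | B | A) (B' | A' | B' | A') he <;>
      simp only [Sum.elim_inl, Sum.elim_inr] at he <;>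
      obtain ⟨h1, h2⟩ := inp_inj h (by norm_num) (by norm_num) he <;>
      (try simp at h1) <;>
      first
      | rw [hB _ _ h2]
      | rw [hA _ _ h2]
  · simp only [effKey, roundFnT_eq, Sum.elim_inl, Sum.elim_inr]

set_option synthInstance.maxSize 1024 in
-- (the `DecidableEq` instance of the four-fold product `LRKey` exceeds the default instance size bound)
/-- **All fibres of the effective key have the same size** (for `d + 8 ≤ μ`). [folklore] -/
theorem card_fibre_effKey_const (h : d + 8 ≤ μ) :
    ∃ M : ℕ, ∀ (e : LRKey (d / 2) (d - d / 2)) [DecidablePred fun H : PrfTable μ => effKey H d = e],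
      (univ.filter fun H : PrfTable μ => effKey H d = e).card = M := by
  have hd : d ≤ μ := by omega
  obtain ⟨ι, hι, hfac⟩ := effKey_factor h
  refine ⟨?_, fun e _ => ?_⟩
  rotate_left
  rw [Finset.filter_congr fun H _ => show effKey H d = e ↔
    (fun c : (Fin (d - d / 2) → Bool) ⊕ (Fin (d / 2) → Bool) ⊕ (Fin (d - d / 2) → Bool) ⊕ (Fin (d / 2) → Bool) →
        (Fin μ → Bool) =>
      ((fun B => (splitVec d (vecOf d (List.ofFn (c (Sum.inl B))))).1,
        fun A => (splitVec d (vecOf d (List.ofFn (c (Sum.inr (Sum.inl A)))))).2,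
        fun B => (splitVec d (vecOf d (List.ofFn (c (Sum.inr (Sum.inr (Sum.inl B))))))).1,
        fun A => (splitVec d (vecOf d (List.ofFn (c (Sum.inr (Sum.inr (Sum.inr A))))))).2) :
          LRKey (d / 2) (d - d / 2)))
      ((fun (T : PrfTable μ) s => T (ι s)) H) = e by rw [hfac H]]
  exact card_fibre_comp (fun (T : PrfTable μ) s => T (ι s)) _ _ _ (card_fibre_restrict ι hι)
    (card_fibre_key4 _ _ _ _ (card_fibre_low hd) (card_fibre_high hd)) e

end PrpTable

/-! ## The registered stub -/

open Classical in
/-- **Stub `stub_prpTable`** (format bridge): (i) the generator's keyed permutation `prp` over the table scheme IS the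
abstract Feistel `psi` of the effective key of the selected table, conjugated by `splitVec`/`joinVec`; (ii) for
`d + 8 ≤ μ` the effective key of a uniformly random `μ`-bit table is a uniformly random Luby–Rackoff key (all
fibres of `H ↦ effKey H d` have the same size: the four round families read the table at pairwise distinct,
domain-separated inputs and use complementary coordinate blocks of the values).
[cite: LubyRackoff1988, main construction] -/
theorem stub_prpTable :
    (∀ (μ d : ℕ) (H : CodeSpace μ) (i : Fin 4) (w : Fin d → Bool),
      prp (tabScheme H) μ (tkey i) d w = joinVec d (psi (effKey (H.tab i) d) (splitVec d w))) ∧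
    (∀ (μ d : ℕ), d + 8 ≤ μ → ∀ e : LRKey (d / 2) (d - d / 2),
      (Finset.univ.filter fun H : PrfTable μ => effKey H d = e).card * Fintype.card (LRKey (d / 2) (d - d / 2)) =
        Fintype.card (PrfTable μ)) := by
  refine ⟨fun μ d H i w => PrpTable.prp_tabScheme H i w, fun μ d h e => ?_⟩
  obtain ⟨M, hM⟩ := PrpTable.card_fibre_effKey_const (μ := μ) h
  rw [hM e]
  exact PrpTable.mul_card_of_fibre (fun H : PrfTable μ => effKey H d) M fun e' => hM e'

end Summit.QuantumAdvantage.QuantumAdvantage.Theorems.WbwObfuscatedGluedTrees.KnowledgeOfWalk.RealIdeal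

end
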